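import Summits.FinalStateConjecture.FinalStateConjecture.Theorems.EIHFluxBalanceModulatedKerrHandoffOneHoleLeibniz
import Summits.FinalStateConjecture.FinalStateConjecture.Theorems.EIHFluxBalanceInertialRecessionCalculus
import Summits.FinalStateConjecture.FinalStateConjecture.Theorems.EIHFluxBalanceInertialRecessionLorentz
import Literature.Geometry.Lorentzian.KerrEnergyIdentity

/-!
# Route EIHFluxBalance — `ModulatedKerrHandoff`, stub `stub_oneHoleMatching`: the boosted Kerr–Schild kernel

Helper file for the crux `stmt-FinalStateConjecture-10167`
(`Summit.FinalStateConjecture.FinalStateConjecture.Theses.EIHFluxBalance.ModulatedKerrHandoff`),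
line `photon-rocket-modulation`, stub `stub_oneHoleMatching` (one-hole profile matching).

Both profiles compared by the stub — the instantaneous summand
`boostedKerrBilin (Λ(x⁰)) (x⁰, ξ(x⁰)) M a x − η` and the retarded summand
`boostedKerrBilin (Λ(U x)) (U x, ξ(U x)) (Mf(U x)) a x − η` — are values of ONE smooth kernel on the
parameter space `P = ℝ × (E4 →L E4) × ℝ × E3`,

  `𝔉(m, L, a′, w) = (g_{m,a′}(0, w) − η)(L·, L·)`,

read at `(mass, inverse boost, εa, ε · rest-frame spatial position)` and multiplied by the scale
`ε > 0` (`boostedKerrBilin_sub_eq_smul_kernel`): this is mass-linearity (`Kerr.ksPert_eq`), homogeneity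
(`Kerr.ksPert_smul`), stationarity (`Kerr.ksPert_eq_of_spatial_eq`) and Lorentz invariance of `η`
(`boostedKerrBilin_sub_minkowski_apply`) of the Kerr–Schild ansatz (Kerr–Schild 1965, §2). The kernel
is polynomial in `(m, L)` and smooth in `(a′, w)` off the ring `{r_{a′}(0, w) = 0}`
(`Kerr.contDiffAt_ksPert₂`), hence `C^∞` on the open set `{0 < r_{a′}(0,w)}` (`contDiffOn_kernel`), and
all its derivatives of order `≤ n` are bounded by one constant on each compact parameter box
`{|m| ≤ M_b, ‖L‖ ≤ L_b, |a′| ≤ a_b, ‖w‖ ≤ R_b, r_b ≤ r_{a′}(0, w)}` (`exists_ck_kernel`). No new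
definitions: the kernel is always written as the explicit lambda. The mass is kept INSIDE the
Kerr–Schild form (no scalar multiple of a form-valued map, whose bounded-scalar-action instance Lean
does not find on `E4 →L E4 →L ℝ`).
-/

noncomputable section

-- `Summit.<S>.<S>.…` (single-problem summit, D-0017) trips core's duplicate-namespace linter.
set_option linter.dupNamespace false

open Set Filter Function Literature.Geometry.Lorentzian
open scoped Topology ContDiff

namespace Summit.FinalStateConjecture.FinalStateConjecture.Theorems

namespace OneHole

/-! ### The kernel identity -/

/-- `S (0, w) = w` for the rest-frame slice embedding. [folklore] -/
theorem spatial_ofTimeSpace_zero (w : E3) : E4.spatial (E4.ofTimeSpace 0 w) = w :=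
  E4.spatial_ofTimeSpace 0 w

/-- **Mass-linearity of the Kerr–Schild term**, applied form: `(g_{M,a} − η)(v, w) = M (g_{1,a} − η)(v, w)`
(`H = M r³/(r⁴ + a²z²)`; Kerr–Schild 1965, §2). [cite: KerrSchild1965, §2] -/
theorem ksPert_apply_eq_mul (M a : ℝ) (x v w : E4) :
    (Kerr.bilin M a x - Minkowski.bilin) v w = M * (Kerr.bilin 1 a x - Minkowski.bilin) v w := by
  simp only [FunLike.coe_sub, Pi.sub_apply, Kerr.bilin_apply, Kerr.scalarH]
  ring

/-- **The boosted Kerr–Schild perturbation is a scaled value of the kernel.** For every `ε > 0`,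
`boostedKerrBilin Λ c M a y − η = ε • [ (g_{M,εa}(0, ε S Λ⁻¹(y − c)) − η)(Λ⁻¹·, Λ⁻¹·) ]`
(mass-linearity, homogeneity and stationarity of the Kerr–Schild ansatz, Kerr–Schild 1965, §2, and
Lorentz invariance of `η`). [cite: KerrSchild1965, §2] -/
theorem boostedKerrBilin_sub_eq_smul_kernel (Λ : lorentzGroup) (c : E4) (M a : ℝ) {ε : ℝ} (hε : 0 < ε)
    (y : E4) :
    boostedKerrBilin Λ c M a y - Minkowski.bilin =
      ε • ((fun p : ℝ × ((E4 →L[ℝ] E4) × (ℝ × E3)) ↦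
        (Kerr.bilin p.1 p.2.2.1 (E4.ofTimeSpace 0 p.2.2.2) - Minkowski.bilin).bilinearComp p.2.1 p.2.1)
        (M, (((Λ : E4 ≃L[ℝ] E4).symm : E4 ≃L[ℝ] E4) : E4 →L[ℝ] E4), ε * a,
          ε • E4.spatial ((Λ : E4 ≃L[ℝ] E4).symm (y - c)))) := by
  refine ContinuousLinearMap.ext fun v ↦ ContinuousLinearMap.ext fun w ↦ ?_
  rw [boostedKerrBilin_sub_minkowski_apply]
  simp only [FunLike.coe_smul, Pi.smul_apply, ContinuousLinearMap.bilinearComp_apply,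
    ContinuousLinearEquiv.coe_coe, smul_eq_mul]
  set z : E4 := (Λ : E4 ≃L[ℝ] E4).symm (y - c) with hz
  have hP : poincareInv Λ c y = z := rfl
  rw [hP, Kerr.ksPert_smul hε M a z]
  have hsp : E4.spatial (ε • z) = E4.spatial (E4.ofTimeSpace 0 (ε • E4.spatial z)) := by
    rw [spatial_ofTimeSpace_zero, map_smul]
  rw [Kerr.ksPert_eq_of_spatial_eq 1 (ε * a) hsp]
  simp only [FunLike.coe_smul, Pi.smul_apply, smul_eq_mul]
  rw [ksPert_apply_eq_mul M]
  ring

/-! ### Smoothness of the kernel -/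

/-- **The Kerr–Schild perturbation is jointly `Cⁿ` in (mass, spin, point)** wherever `r > 0`:
`(m, a′, x) ↦ g_{m,a′}(x) − η = 2 m H₁ ℓ ⊗ ℓ` with `H₁`, `ℓ` jointly smooth in `(a′, x)`
(`Kerr.contDiffAt_scalarH₂`, `Kerr.contDiffAt_nullCovector₂`). Kerr–Schild 1965, §3.
[cite: KerrSchild1965, §3] -/
theorem contDiffAt_ksPert₃ {q : ℝ × (ℝ × E4)} (hq : 0 < Kerr.radius q.2.1 q.2.2) {n : WithTop ℕ∞} :
    ContDiffAt ℝ n (fun q : ℝ × (ℝ × E4) ↦ Kerr.bilin q.1 q.2.1 q.2.2 - Minkowski.bilin) q := by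
  have hl : ContDiffAt ℝ n (fun q : ℝ × (ℝ × E4) ↦ Kerr.nullCovector q.2.1 q.2.2) q :=
    (Kerr.contDiffAt_nullCovector₂ (p := q.2) hq).comp q contDiffAt_snd
  have hH : ContDiffAt ℝ n (fun q : ℝ × (ℝ × E4) ↦ Kerr.scalarH 1 q.2.1 q.2.2) q :=
    (Kerr.contDiffAt_scalarH₂ 1 (p := q.2) hq).comp q contDiffAt_snd
  have : (fun q : ℝ × (ℝ × E4) ↦ Kerr.bilin q.1 q.2.1 q.2.2 - Minkowski.bilin) = fun q ↦
      E4.tmul ((2 * (q.1 * Kerr.scalarH 1 q.2.1 q.2.2)) • Kerr.nullCovector q.2.1 q.2.2)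
        (Kerr.nullCovector q.2.1 q.2.2) := by
    funext q
    rw [Kerr.ksPert_eq, Kerr.tmul_smul_left]
    congr 2
    unfold Kerr.scalarH
    ring
  rw [this]
  exact ((contDiffAt_const.mul (contDiffAt_fst.mul hH)).smul hl).smulRight hl

/-- The rest-frame slice of the kernel: `(m, a′, w) ↦ g_{m,a′}(0, w) − η` is `Cⁿ` wherever the
Kerr–Schild radius is positive (`contDiffAt_ksPert₃` along the linear slice embedding).
[cite: KerrSchild1965, §3] -/
theorem contDiffAt_ksPert_slice {q : ℝ × (ℝ × E3)} (hq : 0 < Kerr.radius q.2.1 (E4.ofTimeSpace 0 q.2.2))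
    {n : WithTop ℕ∞} :
    ContDiffAt ℝ n
      (fun q : ℝ × (ℝ × E3) ↦ Kerr.bilin q.1 q.2.1 (E4.ofTimeSpace 0 q.2.2) - Minkowski.bilin) q := by
  have hlin : ContDiff ℝ n (fun q : ℝ × (ℝ × E3) ↦ ((q.1, (q.2.1, E4.ofTimeSpace 0 q.2.2)) : ℝ × (ℝ × E4))) := by
    refine contDiff_fst.prodMk ((contDiff_fst.comp contDiff_snd).prodMk ?_)
    have : (fun q : ℝ × (ℝ × E3) ↦ E4.ofTimeSpace 0 q.2.2) = fun q ↦ E4.spaceEmbed q.2.2 := rfl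
    rw [this]
    exact E4.spaceEmbed.contDiff.comp (contDiff_snd.comp contDiff_snd)
  exact (contDiffAt_ksPert₃ (q := (q.1, (q.2.1, E4.ofTimeSpace 0 q.2.2))) hq).comp q hlin.contDiffAt

/-- **The kernel is `C^∞` on the open set of positive rest-frame radius** (polynomial in `L` —
`contDiffWithinAt_bilinearComp_self` — and smooth in `(m, a′, w)` there). [cite: KerrSchild1965, §3] -/
theorem contDiffOn_kernel {n : WithTop ℕ∞} :
    IsOpen {p : ℝ × ((E4 →L[ℝ] E4) × (ℝ × E3)) |
        0 < Kerr.radius p.2.2.1 (E4.ofTimeSpace 0 p.2.2.2)} ∧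
      ContDiffOn ℝ n (fun p : ℝ × ((E4 →L[ℝ] E4) × (ℝ × E3)) ↦
        (Kerr.bilin p.1 p.2.2.1 (E4.ofTimeSpace 0 p.2.2.2) - Minkowski.bilin).bilinearComp p.2.1 p.2.1)
        {p | 0 < Kerr.radius p.2.2.1 (E4.ofTimeSpace 0 p.2.2.2)} := by
  have hcont : Continuous fun p : ℝ × ((E4 →L[ℝ] E4) × (ℝ × E3)) ↦
      Kerr.radius p.2.2.1 (E4.ofTimeSpace 0 p.2.2.2) := by
    have h2 : (fun p : ℝ × ((E4 →L[ℝ] E4) × (ℝ × E3)) ↦ Kerr.radius p.2.2.1 (E4.ofTimeSpace 0 p.2.2.2))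
        = fun p ↦ Kerr.radius p.2.2.1 (E4.spaceEmbed p.2.2.2) := rfl
    rw [h2]
    unfold Kerr.radius E4.spatialNorm
    fun_prop
  refine ⟨isOpen_lt continuous_const hcont, fun p hp ↦ ?_⟩
  have hπ : ContDiffAt ℝ n (fun p : ℝ × ((E4 →L[ℝ] E4) × (ℝ × E3)) ↦ ((p.1, p.2.2) : ℝ × (ℝ × E3))) p :=
    contDiffAt_fst.prodMk (contDiffAt_snd.comp p contDiffAt_snd)
  have hT : ContDiffAt ℝ n (fun p : ℝ × ((E4 →L[ℝ] E4) × (ℝ × E3)) ↦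
      Kerr.bilin p.1 p.2.2.1 (E4.ofTimeSpace 0 p.2.2.2) - Minkowski.bilin) p :=
    (contDiffAt_ksPert_slice (q := (p.1, p.2.2)) hp).comp p hπ
  have hB := contDiffWithinAt_bilinearComp_self (s := univ) hT.contDiffWithinAt
    (contDiffAt_fst.comp p contDiffAt_snd).contDiffWithinAt
  exact (contDiffWithinAt_univ.mp hB).contDiffWithinAt

/-! ### Uniform size of the kernel on compact parameter boxes -/

/-- `r_{a′}(0, w)² ≥ ‖w‖² − a′²` (Visser arXiv:0706.0622, (35)). [folklore] -/
theorem sq_sub_sq_le_radius_slice_sq (a' : ℝ) (w : E3) :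
    ‖w‖ ^ 2 - a' ^ 2 ≤ Kerr.radius a' (E4.ofTimeSpace 0 w) ^ 2 := by
  have h := Kerr.spatialNorm_sq_sub_sq_le_radius_sq a' (E4.ofTimeSpace 0 w)
  rwa [E4.spatialNorm_ofTimeSpace] at h

/-- **The parameter box is compact and lies in the domain of smoothness.** [folklore] -/
theorem isCompact_paramBox (Mb Lb ab Rb rb : ℝ) :
    IsCompact {p : ℝ × ((E4 →L[ℝ] E4) × (ℝ × E3)) | |p.1| ≤ Mb ∧ ‖p.2.1‖ ≤ Lb ∧ |p.2.2.1| ≤ ab ∧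
      ‖p.2.2.2‖ ≤ Rb ∧ rb ≤ Kerr.radius p.2.2.1 (E4.ofTimeSpace 0 p.2.2.2)} := by
  have hcont : Continuous fun p : ℝ × ((E4 →L[ℝ] E4) × (ℝ × E3)) ↦
      Kerr.radius p.2.2.1 (E4.ofTimeSpace 0 p.2.2.2) := by
    have h2 : (fun p : ℝ × ((E4 →L[ℝ] E4) × (ℝ × E3)) ↦ Kerr.radius p.2.2.1 (E4.ofTimeSpace 0 p.2.2.2))
        = fun p ↦ Kerr.radius p.2.2.1 (E4.spaceEmbed p.2.2.2) := rfl
    rw [h2]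
    unfold Kerr.radius E4.spatialNorm
    fun_prop
  refine Metric.isCompact_of_isClosed_isBounded ?_ ?_
  · refine (isClosed_le (continuous_abs.comp continuous_fst) continuous_const).inter ?_
    refine (isClosed_le (continuous_norm.comp (continuous_fst.comp continuous_snd))
      continuous_const).inter ?_
    refine (isClosed_le (continuous_abs.comp (continuous_fst.comp (continuous_snd.comp
      continuous_snd))) continuous_const).inter ?_
    refine (isClosed_le (continuous_norm.comp (continuous_snd.comp (continuous_snd.comp
      continuous_snd))) continuous_const).inter ?_
    exact isClosed_le continuous_const hcont
  · refine (Metric.isBounded_closedBall (x := (0 : ℝ × ((E4 →L[ℝ] E4) × (ℝ × E3))))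
      (r := max (max |Mb| |Lb|) (max |ab| |Rb|))).subset ?_
    rintro ⟨m, L, a', w⟩ ⟨hm, hL, ha, hw, -⟩
    simp only at hm hL ha hw
    rw [Metric.mem_closedBall, dist_zero_right, Prod.norm_mk, Prod.norm_mk, Prod.norm_mk,
      Real.norm_eq_abs, Real.norm_eq_abs]
    refine max_le (hm.trans ((le_abs_self _).trans ?_)) (max_le (hL.trans ((le_abs_self _).trans ?_))
      (max_le (ha.trans ((le_abs_self _).trans ?_)) (hw.trans ((le_abs_self _).trans ?_))))
    · exact (le_max_left _ _).trans (le_max_left _ _)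
    · exact (le_max_right _ _).trans (le_max_left _ _)
    · exact (le_max_left _ _).trans (le_max_right _ _)
    · exact (le_max_right _ _).trans (le_max_right _ _)

/-- **Uniform size of the kernel on a parameter box.** For every order `n` and box parameters with
`r_b > 0` there is `B ≥ 0` such that at every `p = (m, L, a′, w)` with `|m| ≤ M_b`, `‖L‖ ≤ L_b`,
`|a′| ≤ a_b`, `‖w‖ ≤ R_b`, `r_{a′}(0, w) ≥ r_b`, the kernel is `Cⁿ` with all derivatives of order `≤ n`
bounded by `B` (continuity of the derivatives on the compact box inside the open domain of smoothness).
[cite: KerrSchild1965, §3] -/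
theorem exists_ck_kernel (n : ℕ) (Mb Lb ab Rb : ℝ) {rb : ℝ} (hrb : 0 < rb) :
    ∃ B : ℝ, 0 ≤ B ∧ ∀ p : ℝ × ((E4 →L[ℝ] E4) × (ℝ × E3)),
      |p.1| ≤ Mb → ‖p.2.1‖ ≤ Lb → |p.2.2.1| ≤ ab → ‖p.2.2.2‖ ≤ Rb →
      rb ≤ Kerr.radius p.2.2.1 (E4.ofTimeSpace 0 p.2.2.2) →
      ContDiffAt ℝ n (fun p : ℝ × ((E4 →L[ℝ] E4) × (ℝ × E3)) ↦
        (Kerr.bilin p.1 p.2.2.1 (E4.ofTimeSpace 0 p.2.2.2) - Minkowski.bilin).bilinearComp p.2.1 p.2.1) p ∧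
      ∀ i ≤ n, ‖iteratedFDeriv ℝ i (fun p : ℝ × ((E4 →L[ℝ] E4) × (ℝ × E3)) ↦
        (Kerr.bilin p.1 p.2.2.1 (E4.ofTimeSpace 0 p.2.2.2) - Minkowski.bilin).bilinearComp p.2.1 p.2.1) p‖
        ≤ B := by
  obtain ⟨hO, hF⟩ := contDiffOn_kernel (n := n)
  obtain ⟨B, hB0, hB⟩ := exists_forall_ck_of_isCompact hO hF (isCompact_paramBox Mb Lb ab Rb rb)
    (fun p hp ↦ hrb.trans_le hp.2.2.2.2)
  exact ⟨B, hB0, fun p h1 h2 h3 h4 h5 ↦ hB p ⟨h1, h2, h3, h4, h5⟩⟩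

end OneHole

/-- Registered sub-goal form (stub `oneHole_kernel_identity` of the crux item) of
`OneHole.boostedKerrBilin_sub_eq_smul_kernel`: the boosted Kerr–Schild perturbation is a scaled value of
the explicit kernel on `ℝ × (E4 →L E4) × ℝ × E3` (Kerr–Schild 1965, §2). [cite: KerrSchild1965, §2] -/
theorem oneHole_kernel_identity : open Literature.Geometry.Lorentzian in ∀ (Λ : lorentzGroup) (c : E4) (M a : ℝ) {ε : ℝ}, 0 < ε → ∀ y : E4, boostedKerrBilin Λ c M a y - Minkowski.bilin = ε • ((fun p : ℝ × ((E4 →L[ℝ] E4) × (ℝ × E3)) ↦ (Kerr.bilin p.1 p.2.2.1 (E4.ofTimeSpace 0 p.2.2.2) - Minkowski.bilin).bilinearComp p.2.1 p.2.1) (M, (((Λ : E4 ≃L[ℝ] E4).symm : E4 ≃L[ℝ] E4) : E4 →L[ℝ] E4), ε * a, ε • E4.spatial ((Λ : E4 ≃L[ℝ] E4).symm (y - c)))) :=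
  fun Λ c M a _ hε y ↦ OneHole.boostedKerrBilin_sub_eq_smul_kernel Λ c M a hε y

end Summit.FinalStateConjecture.FinalStateConjecture.Theorems

end
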